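import Literature.NumberTheory.LFunctions.DobnerNewman
import Literature.Analysis.Complex.HolomorphicPrimitives
import Mathlib.Analysis.Complex.BorelCaratheodory
import Mathlib.Analysis.Complex.Liouville
import Mathlib.Analysis.Complex.TaylorSeries
import Mathlib.NumberTheory.LSeries.Injectivity
import HarnessLib

/-!
# Dobner's Lemma 3: `ζ_t` has a zero for every `t < 0` — the discharge

Trunk T-ANT (`Literature/NumberTheory/LFunctions`). Proofs only, companion of `DobnerNewman.lean`:
**discharge of the named fact `Literature.NumberTheory.LFunctions.dobner_zetaDeformed_exists_zero`** (A. Dobner, *A proof of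
Newman's conjecture for the extended Selberg class*, Acta Arith. 201 (2021) = arXiv:2005.05142,
**Lemma 3**, proof in §5), for `ζ_t(s) = Σ_{n≥1} e^{(t/4) log² n} n^{-s}`.

## The argument (§5 of the source)

`ζ_t` is entire with `|ζ_t(x+iy)| ≤ ζ̃_t(x) = Σ e^{(t/4)log² n} n^{-x} ≤ S e^{(2/|t|) x²}`, so of
order at most `2`, and it is bounded on every right half-plane `Re s ≥ c`. If it had no zeros,
then `ζ_t = e^g` with `g` entire (holomorphic logarithm on `ℂ`,
`Complex.exists_eq_exp_of_forall_isExactOn` of `Literature/Analysis/Complex/HolomorphicPrimitives.lean`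
with Mathlib's `Differentiable.isExactOn_univ`), `Re g ≤ (2/|t|)|z|² + log S`, so by the
Borel–Carathéodory theorem (Mathlib) `|g(z)| = O(|z|²)` and by Cauchy's estimate `g''' ≡ 0`:
`g(s) = a s² + b s + ρ` (the source invokes Hadamard's factorisation theorem for this step).
Boundedness on right half-planes forces `a = 0` and `b` real `≤ 0`, i.e. `ζ_t(s) = e^ρ e^{−λ s}`,
`λ ≥ 0`; letting `s = x → +∞` (`ζ_t(x) → 1`) gives `λ = 0`, `e^ρ = 1`, `ζ_t ≡ 1`, contradicting
the uniqueness of Dirichlet coefficients (`LSeries_eq_iff_of_abscissaOfAbsConv_lt_top`: the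
coefficient of `2^{-s}` is `e^{(t/4) log² 2} ≠ 0`).

## Main result

* `Literature.dobner_zetaDeformed_exists_zero_holds : dobner_zetaDeformed_exists_zero`.

## References

* A. Dobner, op. cit., Lemma 3 and its proof (§5).
* J. B. Conway, *Functions of One Complex Variable I*, VIII.2.2 (holomorphic logarithms).
-/

noncomputable section

open Complex Filter Set Topology Metric

namespace Literature.NumberTheory.LFunctions

/-! ## Entire zero-free functions of order at most two -/

/-- A zero-free entire function has an entire logarithm. [cite: Conway1978, Ch. VIII Thm. 2.2] -/
theorem exists_entire_log {f : ℂ → ℂ} (hf : Differentiable ℂ f) (h0 : ∀ z, f z ≠ 0) :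
    ∃ g : ℂ → ℂ, Differentiable ℂ g ∧ ∀ z, f z = Complex.exp (g z) := by
  obtain ⟨g, hg, hfg⟩ := Complex.exists_eq_exp_of_forall_isExactOn isOpen_univ
    isPreconnected_univ (fun f hf ↦ (differentiableOn_univ.1 hf).isExactOn_univ)
    hf.differentiableOn (fun z _ ↦ h0 z)
  exact ⟨g, differentiableOn_univ.1 hg, fun z ↦ hfg z (mem_univ z)⟩

/-- Borel–Carathéodory: an entire `g` with `Re g(z) ≤ A|z|² + B` satisfies `|g(z)| ≤ K R²` for
`|z| ≤ R`, `R ≥ 1`. [folklore] -/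
theorem exists_norm_le_sq_of_re_le {g : ℂ → ℂ} (hg : Differentiable ℂ g) {A B : ℝ} (hA : 0 ≤ A)
    (hre : ∀ z : ℂ, (g z).re ≤ A * ‖z‖ ^ 2 + B) :
    ∃ K : ℝ, 0 ≤ K ∧ ∀ R : ℝ, 1 ≤ R → ∀ z : ℂ, ‖z‖ ≤ R → ‖g z‖ ≤ K * R ^ 2 := by
  refine ⟨8 * A + 2 * |B| + 2 + 3 * ‖g 0‖, by positivity, fun R hR z hz ↦ ?_⟩
  set M : ℝ := A * (2 * R) ^ 2 + |B| + 1 with hM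
  have hM0 : 0 < M := by positivity
  have hmaps : MapsTo g (ball 0 (2 * R)) {w : ℂ | w.re ≤ M} := by
    intro w hw
    rw [mem_ball_zero_iff] at hw
    simp only [mem_setOf_eq]
    have h1 := hre w
    have h2 : A * ‖w‖ ^ 2 ≤ A * (2 * R) ^ 2 := by
      refine mul_le_mul_of_nonneg_left ?_ hA
      exact pow_le_pow_left₀ (norm_nonneg _) hw.le 2
    linarith [le_abs_self B]
  have hzball : z ∈ ball (0 : ℂ) (2 * R) := by rw [mem_ball_zero_iff]; linarith
  have hbc := Complex.borelCaratheodory hM0 hg.differentiableOn hmaps (by linarith) hzball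
  have hden : R ≤ 2 * R - ‖z‖ := by linarith
  have hden0 : 0 < 2 * R - ‖z‖ := by linarith
  have e1 : 2 * M * ‖z‖ / (2 * R - ‖z‖) ≤ 2 * M := by
    rw [div_le_iff₀ hden0]
    nlinarith [norm_nonneg z]
  have e2 : ‖g 0‖ * (2 * R + ‖z‖) / (2 * R - ‖z‖) ≤ 3 * ‖g 0‖ := by
    rw [div_le_iff₀ hden0]
    nlinarith [norm_nonneg z, norm_nonneg (g 0)]
  have hR2 : 1 ≤ R ^ 2 := by nlinarith
  calc ‖g z‖ ≤ 2 * M + 3 * ‖g 0‖ := hbc.trans (add_le_add e1 e2)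
    _ = 8 * A * R ^ 2 + (2 * |B| + 2 + 3 * ‖g 0‖) := by rw [hM]; ring
    _ ≤ 8 * A * R ^ 2 + (2 * |B| + 2 + 3 * ‖g 0‖) * R ^ 2 := by
        gcongr
        exact le_mul_of_one_le_right (by positivity) hR2
    _ = (8 * A + 2 * |B| + 2 + 3 * ‖g 0‖) * R ^ 2 := by ring

/-- Cauchy's estimate: an entire `g` with `|g(z)| ≤ K R²` on `|z| ≤ R` (`R ≥ 1`) has `g''' ≡ 0`.
[folklore] -/
theorem iteratedDeriv_three_eq_zero {g : ℂ → ℂ} (hg : Differentiable ℂ g) {K : ℝ}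
    (hK : ∀ R : ℝ, 1 ≤ R → ∀ z : ℂ, ‖z‖ ≤ R → ‖g z‖ ≤ K * R ^ 2) (z₀ : ℂ) :
    iteratedDeriv 3 g z₀ = 0 := by
  rw [← norm_le_zero_iff]
  refine le_of_forall_pos_le_add fun ε hε ↦ ?_
  rw [zero_add]
  -- radius
  set R : ℝ := max (max 1 ‖z₀‖) (24 * K / ε + 1) with hR
  have hR1 : 1 ≤ R := (le_max_left _ _).trans (le_max_left _ _)
  have hRz : ‖z₀‖ ≤ R := (le_max_right _ _).trans (le_max_left _ _)
  have hRε : 24 * K / ε < R := (lt_add_one _).trans_le (le_max_right _ _)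
  have hR0 : 0 < R := by linarith
  have hbound : ∀ z ∈ sphere z₀ R, ‖g z‖ ≤ K * (2 * R) ^ 2 := by
    intro z hz
    refine hK (2 * R) (by linarith) z ?_
    rw [mem_sphere, dist_eq_norm] at hz
    calc ‖z‖ = ‖(z - z₀) + z₀‖ := by rw [sub_add_cancel]
      _ ≤ ‖z - z₀‖ + ‖z₀‖ := norm_add_le _ _
      _ ≤ 2 * R := by rw [hz]; linarith
  have hc := Complex.norm_iteratedDeriv_le_of_forall_mem_sphere_norm_le 3 hR0
    (hg.differentiableOn.diffContOnCl_ball (subset_univ _)) hbound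
  have e : (Nat.factorial 3 : ℝ) * (K * (2 * R) ^ 2) / R ^ 3 = 24 * K / R := by
    rw [show (Nat.factorial 3 : ℝ) = 6 by norm_num]
    field_simp
    ring
  rw [e] at hc
  refine hc.trans ?_
  rw [div_le_iff₀ hR0]
  rw [div_lt_iff₀ hε] at hRε
  linarith

/-- An entire function with `g''' ≡ 0` is a quadratic polynomial. [folklore] -/
theorem eq_quadratic_of_iteratedDeriv_three {g : ℂ → ℂ} (hg : Differentiable ℂ g)
    (h3 : ∀ z, iteratedDeriv 3 g z = 0) (z : ℂ) :
    g z = g 0 + deriv g 0 * z + deriv (deriv g) 0 / 2 * z ^ 2 := by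
  have hzero : ∀ n : ℕ, 3 ≤ n → iteratedDeriv n g = 0 := by
    intro n hn
    induction n with
    | zero => omega
    | succ n ih =>
      rcases Nat.lt_or_ge n 3 with h | h
      · have : n = 2 := by omega
        subst this
        funext w
        exact h3 w
      · rw [iteratedDeriv_succ, ih h]
        funext w
        simp
  have hsum := Complex.hasSum_taylorSeries_of_entire hg 0 z
  have hfin : HasSum (fun n : ℕ ↦ (n.factorial : ℂ)⁻¹ • (z - 0) ^ n • iteratedDeriv n g 0)
      (∑ n ∈ Finset.range 3, (n.factorial : ℂ)⁻¹ • (z - 0) ^ n • iteratedDeriv n g 0) :=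
    hasSum_sum_of_ne_finset_zero fun n hn ↦ by
      simp only [Finset.mem_range, not_lt] at hn
      simp [hzero n hn]
  have := hsum.unique hfin
  rw [this, Finset.sum_range_succ, Finset.sum_range_succ, Finset.sum_range_succ, Finset.sum_range_zero]
  simp only [sub_zero, Nat.factorial, iteratedDeriv_zero, iteratedDeriv_one, smul_eq_mul]
  rw [show iteratedDeriv 2 g = deriv (deriv g) by
    rw [show (2 : ℕ) = 1 + 1 from rfl, iteratedDeriv_succ, iteratedDeriv_one]]
  push_cast
  ring

/-! ## Quadratics bounded above on lines and half-lines -/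

/-- If `p y² + q y + r ≤ B` for all real `y`, then `p ≤ 0`, and `q = 0` when `p = 0`. [folklore] -/
theorem quad_le_forall {p q r B : ℝ} (h : ∀ y : ℝ, p * y ^ 2 + q * y + r ≤ B) :
    p ≤ 0 ∧ (p = 0 → q = 0) := by
  constructor
  · by_contra hp
    push Not at hp
    set N : ℝ := |q| + |r| + |B| + 1 with hN
    have hN0 : 0 ≤ N := by rw [hN]; positivity
    set y : ℝ := N / p + 1 with hy
    have hy0 : 0 ≤ N / p := by positivity
    have hy1 : 1 ≤ y := by rw [hy]; linarith
    have hpy : p * y = N + p := by rw [hy]; field_simp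
    have hineq := h y
    have e : p * y ^ 2 + q * y + r = y * (p * y) + q * y + r := by ring
    rw [e, hpy] at hineq
    have k1 : y * (N + p) = y * |q| + y * |r| + y * |B| + y + y * p := by rw [hN]; ring
    rw [k1] at hineq
    have k2 : 0 ≤ y * |q| + q * y := by
      have := mul_nonneg (by linarith : (0 : ℝ) ≤ y) (by linarith [neg_abs_le q] : 0 ≤ |q| + q)
      linarith [this, show y * (|q| + q) = y * |q| + q * y by ring]
    have k3 : |r| ≤ y * |r| := le_mul_of_one_le_left (abs_nonneg r) hy1
    have k4 : |B| ≤ y * |B| := le_mul_of_one_le_left (abs_nonneg B) hy1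
    have k5 : 0 ≤ y * p := by positivity
    linarith [le_abs_self B, neg_abs_le r]
  · intro hp
    subst hp
    by_contra hq
    have := h ((B - r + 1) / q)
    rw [zero_mul, zero_add, mul_div_cancel₀ _ hq] at this
    linarith

/-- If `α x² + β x + γ ≤ B` for all `x ≥ c`, then `α ≤ 0`, and `β ≤ 0` when `α = 0`. [folklore] -/
theorem quad_le_forall_ge {α β γ B c : ℝ} (h : ∀ x : ℝ, c ≤ x → α * x ^ 2 + β * x + γ ≤ B) :
    α ≤ 0 ∧ (α = 0 → β ≤ 0) := by
  constructor
  · by_contra hα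
    push Not at hα
    set N : ℝ := |β| + |γ| + |B| + 1 with hN
    have hN0 : 0 ≤ N := by rw [hN]; positivity
    set x : ℝ := N / α + |c| + 1 with hx
    have hx0 : 0 ≤ N / α := by positivity
    have hx1 : 1 ≤ x := by rw [hx]; linarith [abs_nonneg c]
    have hxc : c ≤ x := by rw [hx]; linarith [le_abs_self c]
    have hαx : α * x = N + α * (|c| + 1) := by rw [hx]; field_simp; ring
    have hineq := h x hxc
    have e : α * x ^ 2 + β * x + γ = x * (α * x) + β * x + γ := by ring
    rw [e, hαx] at hineq
    have k1 : x * (N + α * (|c| + 1)) = x * |β| + x * |γ| + x * |B| + x + x * (α * (|c| + 1)) := by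
      rw [hN]; ring
    rw [k1] at hineq
    have k2 : 0 ≤ x * |β| + β * x := by
      have := mul_nonneg (by linarith : (0 : ℝ) ≤ x) (by linarith [neg_abs_le β] : 0 ≤ |β| + β)
      linarith [this, show x * (|β| + β) = x * |β| + β * x by ring]
    have k3 : |γ| ≤ x * |γ| := le_mul_of_one_le_left (abs_nonneg γ) hx1
    have k4 : |B| ≤ x * |B| := le_mul_of_one_le_left (abs_nonneg B) hx1
    have k5 : 0 ≤ x * (α * (|c| + 1)) := by positivity
    linarith [le_abs_self B, neg_abs_le γ]
  · intro hα
    subst hα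
    by_contra hβ
    push Not at hβ
    set N : ℝ := |γ| + |B| + 1 with hN
    set x : ℝ := N / β + |c| with hx
    have hx0 : 0 ≤ N / β := by positivity
    have hxc : c ≤ x := by rw [hx]; linarith [le_abs_self c]
    have hineq := h x hxc
    have hβx : β * x = N + β * |c| := by rw [hx]; field_simp
    rw [zero_mul, zero_add, hβx] at hineq
    have k5 : 0 ≤ β * |c| := by positivity
    rw [hN] at hineq
    linarith [le_abs_self B, neg_abs_le γ]

/-- A quadratic exponent `a s² + b s + ρ` whose real part is bounded above on every right
half-plane is linear with real non-positive slope: `a = 0`, `Im b = 0`, `Re b ≤ 0`. [folklore] -/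
theorem quadratic_coeffs_of_bounded {a b ρ : ℂ}
    (hbd : ∀ c : ℝ, ∃ B : ℝ, ∀ s : ℂ, c ≤ s.re → (a * s ^ 2 + b * s + ρ).re ≤ B) :
    a = 0 ∧ b.im = 0 ∧ b.re ≤ 0 := by
  -- vertical lines `s = c + iy`
  have hvert : ∀ c : ℝ, -a.re ≤ 0 ∧ (-a.re = 0 → -(2 * c * a.im + b.im) = 0) := by
    intro c
    obtain ⟨B, hB⟩ := hbd c
    refine quad_le_forall (r := a.re * c ^ 2 + b.re * c + ρ.re) (B := B) fun y ↦ ?_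
    have := hB (c + y * I) (by simp)
    have e : (a * (c + y * I) ^ 2 + b * (c + y * I) + ρ).re =
        -a.re * y ^ 2 + -(2 * c * a.im + b.im) * y + (a.re * c ^ 2 + b.re * c + ρ.re) := by
      have : (a * (c + y * I) ^ 2 + b * (c + y * I) + ρ : ℂ) =
          a * ((c : ℂ) ^ 2 - (y : ℂ) ^ 2) + a * (2 * c * y) * I + b * c + b * y * I + ρ := by
        ring_nf
        rw [Complex.I_sq]
        ring
      rw [this]
      simp only [add_re, mul_re, sub_re, mul_im, sub_im, I_re, I_im, ofReal_re, ofReal_im,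
        mul_zero, mul_one, sub_zero]
      norm_cast
      ring
    rwa [e] at this
  -- the real axis
  have hreal : a.re ≤ 0 ∧ (a.re = 0 → b.re ≤ 0) := by
    obtain ⟨B, hB⟩ := hbd 0
    refine quad_le_forall_ge (γ := ρ.re) (B := B) (c := 0) fun x hx ↦ ?_
    have := hB x (by simpa using hx)
    have e : (a * (x : ℂ) ^ 2 + b * x + ρ).re = a.re * x ^ 2 + b.re * x + ρ.re := by
      have : (a * (x : ℂ) ^ 2 + b * x + ρ : ℂ) = a * ((x ^ 2 : ℝ) : ℂ) + b * x + ρ := by push_cast; ring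
      rw [this]
      simp only [add_re, mul_re, ofReal_re, ofReal_im, mul_zero, sub_zero]
    rwa [e] at this
  have hare : a.re = 0 := by linarith [(hvert 0).1, hreal.1]
  have h0 := (hvert 0).2 (by rw [hare, neg_zero])
  have h1 := (hvert 1).2 (by rw [hare, neg_zero])
  have hbim : b.im = 0 := by linarith
  have haim : a.im = 0 := by linarith
  exact ⟨Complex.ext (by simpa using hare) (by simpa using haim), hbim, hreal.2 hare⟩

/-! ## Growth of `ζ_t` -/

/-- `|n^{-s}|`-comparison of the terms of `ζ_t`: for `Re s ≥ c`, `‖term s n‖ ≤ ‖term c n‖`.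
[folklore] -/
theorem norm_term_zetaDeformed_le_of_le_re (t : ℝ) {c : ℝ} {s : ℂ} (hs : c ≤ s.re) (n : ℕ) :
    ‖LSeries.term (zetaDeformedCoeff t) s n‖ ≤ ‖LSeries.term (zetaDeformedCoeff t) c n‖ := by
  rcases Nat.eq_zero_or_pos n with rfl | hn
  · simp
  rw [LSeries.norm_term_eq, LSeries.norm_term_eq, if_neg hn.ne', if_neg hn.ne', ofReal_re]
  have hn1 : (1 : ℝ) ≤ n := by exact_mod_cast hn
  exact div_le_div_of_nonneg_left (norm_nonneg _) (Real.rpow_pos_of_pos (by linarith) _)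
    (Real.rpow_le_rpow_of_exponent_le hn1 hs)

/-- `ζ_t` is bounded on every right half-plane (by `ζ̃_t(c) = Σ e^{(t/4)log² n} n^{-c}`).
[cite: Dobner2021, §5 (proof of Lemma 3)] -/
theorem exists_norm_zetaDeformed_le_of_le_re {t : ℝ} (ht : t < 0) (c : ℝ) :
    ∃ B : ℝ, ∀ s : ℂ, c ≤ s.re → ‖zetaDeformed t s‖ ≤ B := by
  refine ⟨∑' n : ℕ, ‖LSeries.term (zetaDeformedCoeff t) c n‖, fun s hs ↦ ?_⟩
  rw [zetaDeformed, LSeries]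
  refine (norm_tsum_le_tsum_norm (zetaDeformed_summable ht s).norm).trans ?_
  exact Summable.tsum_le_tsum (fun n ↦ norm_term_zetaDeformed_le_of_le_re t hs n)
    (zetaDeformed_summable ht s).norm (zetaDeformed_summable ht c).norm

/-- Order at most two: `‖ζ_t(s)‖ ≤ S e^{(2/|t|) (Re s)²}` with `S = Σ e^{(t/8) log² n}`
(`(t/4)L² − xL ≤ (t/8)L² + 2x²/|t|` by the AM–GM inequality). [cite: Dobner2021, §5 (proof of Lemma 3)] -/
theorem exists_norm_zetaDeformed_le_exp_sq {t : ℝ} (ht : t < 0) :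
    ∃ S : ℝ, 0 < S ∧ ∀ s : ℂ, ‖zetaDeformed t s‖ ≤ S * Real.exp (2 / |t| * s.re ^ 2) := by
  have ht2 : t / 2 < 0 := by linarith
  set S : ℝ := ∑' n : ℕ, ‖LSeries.term (zetaDeformedCoeff (t / 2)) 0 n‖ with hS
  have hSsum := (zetaDeformed_summable ht2 0).norm
  have h1 : ‖LSeries.term (zetaDeformedCoeff (t / 2)) 0 1‖ = 1 := by
    simp [LSeries.term, zetaDeformedCoeff]
  have hSpos : 0 < S :=
    hSsum.tsum_pos (fun n ↦ norm_nonneg _) 1 (by rw [h1]; exact one_pos)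
  refine ⟨S, hSpos, fun s ↦ ?_⟩
  have habs : |t| = -t := abs_of_neg ht
  have hterm : ∀ n : ℕ, ‖LSeries.term (zetaDeformedCoeff t) s n‖ ≤
      Real.exp (2 / |t| * s.re ^ 2) * ‖LSeries.term (zetaDeformedCoeff (t / 2)) 0 n‖ := by
    intro n
    rcases Nat.eq_zero_or_pos n with rfl | hn
    · simp
    have hnpos : (0 : ℝ) < n := by exact_mod_cast hn
    rw [LSeries.term_of_ne_zero hn.ne', LSeries.term_of_ne_zero hn.ne', norm_div, norm_div,
      Complex.norm_natCast_cpow_of_pos hn, Complex.norm_natCast_cpow_of_pos hn, zetaDeformedCoeff,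
      zetaDeformedCoeff, Complex.norm_real, Complex.norm_real, Real.norm_eq_abs, Real.norm_eq_abs,
      abs_of_pos (Real.exp_pos _), abs_of_pos (Real.exp_pos _), Complex.zero_re, Real.rpow_zero,
      div_one, div_eq_mul_inv, ← Real.rpow_neg hnpos.le, Real.rpow_def_of_pos hnpos,
      ← Real.exp_add, ← Real.exp_add]
    apply Real.exp_le_exp.2
    set L := Real.log n
    set x := s.re
    rw [habs]
    -- `(t/4)L² − xL ≤ 2x²/(−t) + (t/8) L²`
    have ht' : 0 < -t := by linarith
    have htne : t ≠ 0 := ht.ne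
    have key : -(x * L) ≤ 2 / -t * x ^ 2 + -t / 8 * L ^ 2 := by
      have hsq : 0 ≤ (2 / -t) * (x + (-t) / 4 * L) ^ 2 := by positivity
      have e : (2 / -t) * (x + (-t) / 4 * L) ^ 2 = 2 / -t * x ^ 2 + x * L + -t / 8 * L ^ 2 := by
        field_simp
        ring
      linarith
    have : t / 4 * L ^ 2 + L * -x = (t / 8 * L ^ 2) + (-(x * L) + -(-t / 8 * L ^ 2)) := by ring
    rw [this]
    have : t / 2 / 4 * L ^ 2 = t / 8 * L ^ 2 := by ring
    rw [this]
    linarith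
  rw [zetaDeformed, LSeries]
  refine (norm_tsum_le_tsum_norm (zetaDeformed_summable ht s).norm).trans ?_
  calc ∑' n, ‖LSeries.term (zetaDeformedCoeff t) s n‖
      ≤ ∑' n, Real.exp (2 / |t| * s.re ^ 2) * ‖LSeries.term (zetaDeformedCoeff (t / 2)) 0 n‖ :=
        Summable.tsum_le_tsum hterm (zetaDeformed_summable ht s).norm (hSsum.mul_left _)
    _ = Real.exp (2 / |t| * s.re ^ 2) * S := by rw [tsum_mul_left]
    _ = S * Real.exp (2 / |t| * s.re ^ 2) := mul_comm _ _

/-! ## The discharge -/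

/-- **Discharge of `Literature.NumberTheory.LFunctions.dobner_zetaDeformed_exists_zero`** (Dobner 2021, Lemma 3): for every
`t < 0` the entire function `ζ_t` has a zero. [cite: Dobner2021, Lemma 3] -/
theorem dobner_zetaDeformed_exists_zero_holds : dobner_zetaDeformed_exists_zero := by
  intro t ht
  by_contra hno
  push Not at hno
  have hd := differentiable_zetaDeformed ht
  -- `ζ_t = e^g`
  obtain ⟨g, hg, hfg⟩ := exists_entire_log hd hno
  -- growth of `Re g`
  obtain ⟨S, hS, hgrowth⟩ := exists_norm_zetaDeformed_le_exp_sq ht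
  have hre : ∀ z : ℂ, (g z).re ≤ 2 / |t| * ‖z‖ ^ 2 + Real.log S := by
    intro z
    have h1 : Real.exp ((g z).re) = ‖zetaDeformed t z‖ := by rw [hfg z, Complex.norm_exp]
    have h2 : ‖zetaDeformed t z‖ ≤ S * Real.exp (2 / |t| * ‖z‖ ^ 2) := by
      refine (hgrowth z).trans ?_
      have hsq : z.re ^ 2 ≤ ‖z‖ ^ 2 :=
        sq_le_sq' (by linarith [abs_re_le_norm z, neg_abs_le z.re]) (Complex.re_le_norm z)
      exact mul_le_mul_of_nonneg_left
        (Real.exp_le_exp.2 (mul_le_mul_of_nonneg_left hsq (by positivity))) hS.le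
    have h3 : Real.exp ((g z).re) ≤ Real.exp (Real.log S + 2 / |t| * ‖z‖ ^ 2) := by
      rw [h1, Real.exp_add, Real.exp_log hS]; exact h2
    have := Real.exp_le_exp.1 h3
    linarith
  obtain ⟨K, hK0, hK⟩ := exists_norm_le_sq_of_re_le hg (by positivity) hre
  have h3 := iteratedDeriv_three_eq_zero hg hK
  have hquad := eq_quadratic_of_iteratedDeriv_three hg h3
  set a : ℂ := deriv (deriv g) 0 / 2 with ha
  set b : ℂ := deriv g 0 with hb
  set ρ : ℂ := g 0 with hρ
  have hgq : ∀ z, g z = a * z ^ 2 + b * z + ρ := fun z ↦ by rw [hquad z]; ring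
  -- boundedness on right half-planes
  have hbd : ∀ c : ℝ, ∃ B : ℝ, ∀ s : ℂ, c ≤ s.re → (a * s ^ 2 + b * s + ρ).re ≤ B := by
    intro c
    obtain ⟨B, hB⟩ := exists_norm_zetaDeformed_le_of_le_re ht c
    have hBpos : 0 < B := (norm_pos_iff.2 (hno c)).trans_le (hB c (by simp))
    refine ⟨Real.log B, fun s hs ↦ ?_⟩
    have h1 : Real.exp ((a * s ^ 2 + b * s + ρ).re) = ‖zetaDeformed t s‖ := by
      rw [hfg s, Complex.norm_exp, hgq s]
    have := hB s hs
    rw [← h1] at this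
    exact (Real.le_log_iff_exp_le hBpos).2 this
  obtain ⟨ha0, hbim, hbre⟩ := quadratic_coeffs_of_bounded hbd
  -- `ζ_t(x) → 1` as `x → +∞`, while `ζ_t(x) = e^ρ e^{b x}`
  have habs : LSeries.abscissaOfAbsConv (zetaDeformedCoeff t) < ⊤ := by
    rw [abscissaOfAbsConv_zetaDeformed ht]; exact bot_lt_top
  have hlim := LSeries.tendsto_atTop habs
  have hc1 : zetaDeformedCoeff t 1 = 1 := by simp [zetaDeformedCoeff]
  rw [hc1] at hlim
  have hform : ∀ x : ℝ, LSeries (zetaDeformedCoeff t) x = Complex.exp ρ * Complex.exp (b * x) := by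
    intro x
    have := hfg x
    rw [zetaDeformed] at this
    rw [this, hgq, ha0, zero_mul, zero_add, add_comm, Complex.exp_add]
  -- `b = 0`
  have hb0 : b = 0 := by
    rcases hbre.lt_or_eq with hlt | heq
    · exfalso
      -- then `ζ_t(x) → 0`
      have hto0 : Tendsto (fun x : ℝ ↦ LSeries (zetaDeformedCoeff t) x) atTop (𝓝 0) := by
        have h1 : Tendsto (fun x : ℝ ↦ Complex.exp ρ * Complex.exp (b * x)) atTop (𝓝 (Complex.exp ρ * 0)) := by
          refine Tendsto.const_mul _ ?_
          rw [tendsto_zero_iff_norm_tendsto_zero]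
          have e : (fun x : ℝ ↦ ‖Complex.exp (b * x)‖) = fun x : ℝ ↦ Real.exp (b.re * x) := by
            funext x; rw [Complex.norm_exp]; simp [hbim]
          rw [e]
          exact Real.tendsto_exp_atBot.comp (tendsto_id.const_mul_atTop_of_neg hlt)
        rw [mul_zero] at h1
        exact h1.congr fun x ↦ (hform x).symm
      exact one_ne_zero (tendsto_nhds_unique hlim hto0)
    · exact Complex.ext (by simpa using heq) (by simpa using hbim)
  -- so `ζ_t ≡ e^ρ = 1`
  have hconst : ∀ x : ℝ, LSeries (zetaDeformedCoeff t) x = Complex.exp ρ := fun x ↦ by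
    rw [hform x, hb0]; simp
  have hρ1 : Complex.exp ρ = 1 :=
    tendsto_nhds_unique (tendsto_const_nhds.congr fun x ↦ (hconst x).symm) hlim
  -- uniqueness of Dirichlet coefficients: compare with `δ` (whose L-series is `1`)
  have hδ : LSeries.abscissaOfAbsConv LSeries.delta < ⊤ := by
    have hsum : LSeriesSummable LSeries.delta 0 := by
      refine summable_of_ne_finset_zero (s := {1}) fun n hn ↦ ?_
      rw [Finset.mem_singleton] at hn
      rw [LSeries.term_delta, if_neg hn]
    exact hsum.abscissaOfAbsConv_le.trans_lt (by simp)
  have heq : (fun x : ℝ ↦ LSeries (zetaDeformedCoeff t) x) =ᶠ[atTop]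
      fun x : ℝ ↦ LSeries LSeries.delta x :=
    Eventually.of_forall fun x ↦ by
      show LSeries (zetaDeformedCoeff t) x = LSeries LSeries.delta x
      rw [hconst x, hρ1, LSeries_delta, Pi.one_apply]
  have h2 := LSeries.eq_of_LSeries_eventually_eq habs hδ heq (n := 2) two_ne_zero
  simp [zetaDeformedCoeff, LSeries.delta] at h2

end Literature.NumberTheory.LFunctions

end
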